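import Mathlib
import HarnessLib
import Literature.MathematicalPhysics.KineticTheory.VelocityFlipNoise
import Summits.AtomisticToContinuum.FouriersLaw.Theorems.JunctionLocalityConductanceLowerBoundStubKuboLinkAux6
import Summits.AtomisticToContinuum.FouriersLaw.Theorems.VanishingNoiseTransferVanishingNoiseBoundFlipResponseFrame
import Summits.AtomisticToContinuum.FouriersLaw.Theorems.VanishingNoiseTransferVanishingNoiseBoundFlipFamilyMoments
import Summits.AtomisticToContinuum.FouriersLaw.Theorems.VanishingNoiseTransferVanishingNoiseBoundFlipKuboOnsager
import Summits.AtomisticToContinuum.FouriersLaw.Theorems.VanishingNoiseTransferVanishingNoiseBoundFlipWeakGrowth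
import Summits.AtomisticToContinuum.FouriersLaw.Theorems.VanishingNoiseTransferVanishingNoiseBoundFlipUniformMoments
import Summits.AtomisticToContinuum.FouriersLaw.Theorems.VanishingNoiseTransferVanishingNoiseBoundFlipWeakContinuity

/-!
# The mixing-free Kubo link of the velocity-flip chain, and stub S3 from a classical forward field

`--supports stmt-AtomisticToContinuum-11976` helper file (crux `VanishingNoiseBound`, route
`VanishingNoiseTransfer`, line `fekete-usc-one-length`, stub S3 `stub_noisyPositiveConductance`, wave 3).

For the pinned anharmonic chain `pinnedChain ω₂ lam β γ` (all parameters `> 0`), `T > 0`, a flip rate `ε > 0`,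
along the unique flip-steady family `μ` of the stub's frame with response coefficient `D_L` at `T`
(`totalCurrent(μ_{L,T+δ/2,T−δ/2})/δ → D_L` along `𝓝[≠] 0`), `L ≥ 2`, `k_b = p_b² − T`, and a classical forward
field `g` of the LEFT bath for the flip-noisy equilibrium generator — `g` smooth, `(L_{T,T} + εS) g = −k_0`
pointwise, with the growth bounds `|g|, |∂_{p_b} g|, |∂²_{p_b} g| ≤ C₁ e^{ϑ₁H}` at the contacts `b ∈ {0, L−1}`,
`0 < ϑ₁`, `2ϑ₁ < 1/T`:

* `flip_kuboLink_of_forwardField` — **`D_L/(L−1) = γ(1 − (γ/T²)⟨g, k_0⟩_{μ_T})`** (the finite-volume Green–Kubo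
  formula of the flip chain, Bonetto–Lebowitz–Rey-Bellet 2000 eq. (32), Rey-Bellet 2003 Rem. 4.4 eq. (56)).
  Proof = the flip twin of `stub_kuboLink_of_contactGradientBoundAt` (crux 11749, helper VI of
  `ForecastSensitivity`): `(L_{T+δ/2,T−δ/2} + εS) g = −k_0 + (γδ/2)(∂²_{p_0} g − ∂²_{p_{L−1}} g)` POINTWISE (the
  flips do not see the bath temperatures); weak flip stationarity of `μ_δ` tested on `g`
  (`pinnedChain_integral_flipGenerator_eq_zero_of_expGrowth`, `…FlipWeakGrowth`), whence the EXACT identity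
  `⟨k_0⟩_δ/δ = (γ/2)(⟨∂²_{p_0} g⟩_δ − ⟨∂²_{p_{L−1}} g⟩_δ)`; weak continuity of the unique flip family at `δ = 0`
  (`flip_tendsto_integral_of_growth`, `…FlipWeakContinuity`, with the uniform moments `flip_uniform_exp_moment`,
  `…FlipUniformMoments`); two Gaussian integrations by parts under `μ_T`; the flip energy balance
  `totalCurrent(μ_δ) = (L−1)γ(T + δ/2 − ⟨p_0²⟩_δ)` (`totalCurrent_eq_left`, `…FlipBondCurrents`); uniqueness of limits
  along `𝓝[≠] 0`; the flip row sum `flip_rowSum` (`…FlipKuboDirichlet`).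
* `flip_response_pos_of_forwardField` — hence **`0 < D_L`** by `flipKubo_pos_and_le` (`…FlipKuboOnsager`).
* `noisyPositiveConductance_of_flipForwardFields` — **stub S3 VERBATIM behind ONE equilibrium regularity
  hypothesis** `FF(ε)`: existence, for all admissible parameters, `T > 0`, `ε > 0`, `L ≥ 2`, of such a classical
  exponentially bounded forward field (hypoelliptic smoothness of the Poisson solution `∫₀^∞ V_t k_0 dt` of the
  NONLOCAL operator `L + εS`; the `ε = 0` twin is the landed `forwardField_contDiff`/`forwardField_abs_le_exp` plus
  the open contact-gradient bound `CG` of crux 11749).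
* `helper_noisyKuboLink` — registered helper (notation-free restatement of `flip_response_pos_of_forwardField`).

References: Bonetto–Lebowitz–Rey-Bellet 2000, eq. (32); Rey-Bellet 2003, Rem. 4.4; Bernardin–Olla 2011 §2.1, §6;
Kundu–Dhar–Narayan 2009.
-/

noncomputable section

open MeasureTheory Filter Topology Set ProbabilityTheory
open scoped ContDiff NNReal ENNReal
open Literature.MathematicalPhysics.KineticTheory.HeatConduction
open Literature.MathematicalPhysics.KineticTheory Literature.Probability.Process OscillatorChain
open Summit.AtomisticToContinuum.FouriersLaw.Theorems
open Summit.AtomisticToContinuum.FouriersLaw.Theorems.OddSectorIrreversibility (generator_temp_split sum_bath_two)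
open Summit.AtomisticToContinuum.FouriersLaw.Theorems.SubdiffusiveBondHeat
open Summit.AtomisticToContinuum.FouriersLaw.Theorems.SuperadditiveResistance.DeviceLiouville (kin kin_eq_sq)
open Summit.AtomisticToContinuum.FouriersLaw.Cruxes.SuperadditiveResistance.FloatingProbeBypassLaplacian
open Summit.AtomisticToContinuum.FouriersLaw.Cruxes.ConductanceLowerBound.ForecastSensitivity
  (pinnedChain_integral_partialP_partialP_gibbsMeasure memLp_two_of_abs_le_exp)

namespace Summit.AtomisticToContinuum.FouriersLaw.Theorems.VanishingNoiseBound

section Link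

variable {ω₂ lam β γ : ℝ}

/-- **The Kubo link of the flip chain from a classical forward field** (mixing-free). See the module
docstring. -/
theorem flip_kuboLink_of_forwardField
    (μ : (N : ℕ) → ℝ → ℝ → Measure (PhaseSpace N)) {T ε : ℝ} (D : ℕ → ℝ)
    (hω : 0 < ω₂) (hl : 0 < lam) (hβ : 0 < β) (hγ : 0 < γ) (hT : 0 < T) (hε : 0 < ε)
    (hμ : ∀ (N : ℕ) (T_L T_R : ℝ), 0 < T_L → 0 < T_R →
      (pinnedChain ω₂ lam β γ).IsFlipSteadyState N T_L T_R ε (μ N T_L T_R) ∧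
        ∀ ν : Measure (PhaseSpace N), (pinnedChain ω₂ lam β γ).IsFlipSteadyState N T_L T_R ε ν → ν = μ N T_L T_R)
    {L : ℕ} (hL2 : 2 ≤ L)
    (hD : Tendsto (fun δ : ℝ =>
        (pinnedChain ω₂ lam β γ).totalCurrent (μ L (T + δ / 2) (T - δ / 2)) / δ) (𝓝[≠] 0) (𝓝 (D L)))
    {g : PhaseSpace L → ℝ} (hgs : ContDiff ℝ ((⊤ : ℕ∞) : WithTop ℕ∞) g)
    (hpde : ∀ x, (pinnedChain ω₂ lam β γ).flipGenerator L T T ε g x = -(kin L 0 x - T))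
    {C₁ ϑ₁ : ℝ} (hϑ₁ : 0 < ϑ₁) (h2ϑ₁ : 2 * ϑ₁ < 1 / T)
    (hgb0 : ∀ x, |g x| ≤ C₁ * Real.exp (ϑ₁ * (pinnedChain ω₂ lam β γ).hamiltonian L x))
    (hgrad : ∀ x,
      |partialP (⟨0, by omega⟩ : Fin L) g x| ≤ C₁ * Real.exp (ϑ₁ * (pinnedChain ω₂ lam β γ).hamiltonian L x) ∧
      |partialP (⟨L - 1, by omega⟩ : Fin L) g x| ≤
        C₁ * Real.exp (ϑ₁ * (pinnedChain ω₂ lam β γ).hamiltonian L x) ∧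
      |partialP (⟨0, by omega⟩ : Fin L) (partialP (⟨0, by omega⟩ : Fin L) g) x| ≤
        C₁ * Real.exp (ϑ₁ * (pinnedChain ω₂ lam β γ).hamiltonian L x) ∧
      |partialP (⟨L - 1, by omega⟩ : Fin L) (partialP (⟨L - 1, by omega⟩ : Fin L) g) x| ≤
        C₁ * Real.exp (ϑ₁ * (pinnedChain ω₂ lam β γ).hamiltonian L x)) :
    D L / ((L : ℝ) - 1) =
      γ * (1 - γ / T ^ 2 * ∫ x, g x * (kin L 0 x - T) ∂((pinnedChain ω₂ lam β γ).gibbsMeasure L T)) := by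
  -- adapted from `stub_kuboLink_of_contactGradientBoundAt` (…ConductanceLowerBoundStubKuboLinkAux6, crux 11749)
  have hL : 0 < L := by omega
  have hL1 : L - 1 < L := by omega
  set P := pinnedChain ω₂ lam β γ with hP
  set μT := P.gibbsMeasure L T with hμT
  haveI : IsProbabilityMeasure μT := pinnedChain_isProbabilityMeasure_gibbsMeasure hω hl.le hβ.le γ L hT
  set i0 : Fin L := ⟨0, hL⟩ with hi0
  set i1 : Fin L := ⟨L - 1, hL1⟩ with hi1
  set H : PhaseSpace L → ℝ := P.hamiltonian L with hH
  have hHc : Continuous H := pinnedChain_continuous_hamiltonian ω₂ lam β γ L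
  have hH0 : ∀ x, 0 ≤ H x := fun x => pinnedChain_hamiltonian_nonneg hω.le hl.le hβ.le γ L x
  have hHflip : ∀ (i : Fin L) (x : PhaseSpace L), H (momentumFlip i x) = H x := fun i x => P.hamiltonian_momentumFlip i x
  -- (1) regularity of `g`
  have hC : ContDiff ℝ 2 g := hgs.of_le (by norm_cast)
  have hgc : Continuous g := hC.continuous
  have hgd : Differentiable ℝ g := hC.differentiable (by norm_num)
  have hg3 : ContDiff ℝ 3 g := hgs.of_le (by norm_cast)
  have hd0s : ContDiff ℝ 2 (partialP i0 g) := contDiff_partialP hg3 (by norm_num) i0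
  have hd1s : ContDiff ℝ 2 (partialP i1 g) := contDiff_partialP hg3 (by norm_num) i1
  have hdd0s : ContDiff ℝ 1 (partialP i0 (partialP i0 g)) := contDiff_partialP hd0s (by norm_num) i0
  have hdd1s : ContDiff ℝ 1 (partialP i1 (partialP i1 g)) := contDiff_partialP hd1s (by norm_num) i1
  have hdd0c : Continuous (partialP i0 (partialP i0 g)) := hdd0s.continuous
  have hdd1c : Continuous (partialP i1 (partialP i1 g)) := hdd1s.continuous
  have hgL2 : MemLp g 2 μT := memLp_two_of_abs_le_exp hω hl.le hβ.le γ L hT h2ϑ₁ hgc hgb0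
  set k : PhaseSpace L → ℝ := fun y => y.2 i0 ^ 2 - T with hk
  have hkc : Continuous k := by rw [hk]; fun_prop
  have hkin : ∀ x : PhaseSpace L, kin L 0 x = x.2 i0 ^ 2 := fun x => kin_eq_sq hL x
  -- (2) one exponent and one constant for all the bounds
  set ϑs : ℝ := ϑ₁ with hϑs
  have hϑs0 : 0 < ϑs := hϑ₁
  have h2ϑs : 2 * ϑs < 1 / T := h2ϑ₁
  have hC₁ : 0 ≤ C₁ := by
    have h := (hgrad 0).1
    exact nonneg_of_mul_nonneg_left ((abs_nonneg _).trans h) (Real.exp_pos _)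
  set Cs : ℝ := C₁ + (2 / ϑs + T) + γ * T * C₁ + ε * (2 * L * C₁) with hCs
  have h2ϑ : 0 ≤ 2 / ϑs := by positivity
  have hγTC : 0 ≤ γ * T * C₁ := by positivity
  have hεLC : 0 ≤ ε * (2 * L * C₁) := by positivity
  have hC₁Cs : C₁ ≤ Cs := by rw [hCs]; linarith
  have hKCs : (2 / ϑs + T) + γ * T * C₁ + ε * (2 * L * C₁) ≤ Cs := by rw [hCs]; linarith
  have hkb : ∀ y, |k y| ≤ (2 / ϑs + T) * Real.exp (ϑs * H y) := fun y =>
    abs_sq_momentum_sub_le_exp hω hl.le hβ.le hϑs0 hT.le y i0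
  have hgb : ∀ x, |g x| ≤ Cs * Real.exp (ϑs * H x) := fun x =>
    (hgb0 x).trans (mul_le_mul_of_nonneg_right hC₁Cs (Real.exp_pos _).le)
  have hP0 : ∀ x, |partialP i0 g x| ≤ Cs * Real.exp (ϑs * H x) := fun x =>
    ((hgrad x).1).trans (mul_le_mul_of_nonneg_right hC₁Cs (Real.exp_pos _).le)
  have hP1 : ∀ x, |partialP i1 g x| ≤ Cs * Real.exp (ϑs * H x) := fun x =>
    ((hgrad x).2.1).trans (mul_le_mul_of_nonneg_right hC₁Cs (Real.exp_pos _).le)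
  -- the flip term `|S g| ≤ 2 L C₁ e^{ϑ₁ H}`
  have hSb : ∀ x, |flipNoise L g x| ≤ 2 * L * C₁ * Real.exp (ϑs * H x) := by
    intro x
    rw [flipNoise_eq]
    calc |∑ i : Fin L, (g (momentumFlip i x) - g x)| ≤ ∑ i : Fin L, |g (momentumFlip i x) - g x| :=
          Finset.abs_sum_le_sum_abs _ _
      _ ≤ ∑ _i : Fin L, 2 * C₁ * Real.exp (ϑs * H x) := by
          refine Finset.sum_le_sum fun i _ => ?_
          have h1 := hgb0 (momentumFlip i x)
          have h1' : |g (momentumFlip i x)| ≤ C₁ * Real.exp (ϑs * H x) := by rw [← hHflip i x]; exact h1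
          have h2 := hgb0 x
          calc |g (momentumFlip i x) - g x| ≤ |g (momentumFlip i x)| + |g x| := abs_sub _ _
            _ ≤ C₁ * Real.exp (ϑs * H x) + C₁ * Real.exp (ϑs * H x) := add_le_add h1' h2
            _ = 2 * C₁ * Real.exp (ϑs * H x) := by ring
      _ = 2 * L * C₁ * Real.exp (ϑs * H x) := by
          simp [Finset.sum_const, Finset.card_univ, Fintype.card_fin]; ring
  -- (3) the generators at temperatures `T ± δ/2` on `g`, pointwise
  have hPγ : P.γ = γ := rfl
  have hsplit : ∀ (δ : ℝ) (x : PhaseSpace L), P.generator L (T + δ / 2) (T - δ / 2) g x =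
      P.generator L T T g x +
        γ * (δ / 2 * partialP i0 (partialP i0 g) x + -(δ / 2) * partialP i1 (partialP i1 g) x) := by
    intro δ x
    rw [show T - δ / 2 = T + -(δ / 2) by ring, generator_temp_split P L T (δ / 2) (-(δ / 2)) g x,
      sum_bath_two hL2, hPγ]
  have hflipTT : ∀ x, P.generator L T T g x = -k x - ε * flipNoise L g x := by
    intro x
    have e := hpde x
    rw [P.flipGenerator_eq_add_flipNoise, hkin x] at e
    rw [hk]
    linarith
  have hLδ : ∀ (δ : ℝ) (x : PhaseSpace L), P.flipGenerator L (T + δ / 2) (T - δ / 2) ε g x =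
      -k x + γ * (δ / 2 * partialP i0 (partialP i0 g) x + -(δ / 2) * partialP i1 (partialP i1 g) x) := by
    intro δ x
    rw [P.flipGenerator_eq_add_flipNoise, hsplit δ x, hflipTT x]
    ring
  have hLδb : ∀ δ : ℝ, |δ| < T → ∀ x, |P.generator L (T + δ / 2) (T - δ / 2) g x| ≤ Cs * Real.exp (ϑs * H x) := by
    intro δ hδ x
    rw [hsplit δ x, hflipTT x]
    obtain ⟨-, -, h3, h4⟩ := hgrad x
    set a := partialP i0 (partialP i0 g) x with ha
    set b := partialP i1 (partialP i1 g) x with hb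
    set e := Real.exp (ϑs * H x) with he
    have hE : 0 ≤ e := (Real.exp_pos _).le
    have hδ' : |δ| / 2 ≤ T / 2 := by linarith
    have hS := hSb x
    have e1 : |-k x - ε * flipNoise L g x + γ * (δ / 2 * a + -(δ / 2) * b)| ≤
        |k x| + ε * |flipNoise L g x| + γ * (|δ| / 2 * |a| + |δ| / 2 * |b|) := by
      calc |-k x - ε * flipNoise L g x + γ * (δ / 2 * a + -(δ / 2) * b)|
          ≤ |-k x - ε * flipNoise L g x| + |γ * (δ / 2 * a + -(δ / 2) * b)| := abs_add_le _ _
        _ ≤ (|-k x| + |ε * flipNoise L g x|) + |γ * (δ / 2 * a + -(δ / 2) * b)| := by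
            gcongr; exact abs_sub _ _
        _ = |k x| + ε * |flipNoise L g x| + γ * |δ / 2 * a + -(δ / 2) * b| := by
            rw [abs_neg, abs_mul, abs_of_pos hε, abs_mul, abs_of_pos hγ]
        _ ≤ |k x| + ε * |flipNoise L g x| + γ * (|δ / 2 * a| + |-(δ / 2) * b|) := by
            gcongr; exact abs_add_le _ _
        _ = |k x| + ε * |flipNoise L g x| + γ * (|δ| / 2 * |a| + |δ| / 2 * |b|) := by
            rw [abs_mul, abs_mul, abs_neg, abs_div, abs_two]
    have hA : |δ| / 2 * |a| ≤ T / 2 * (C₁ * e) := mul_le_mul hδ' h3 (abs_nonneg _) (by positivity)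
    have hB : |δ| / 2 * |b| ≤ T / 2 * (C₁ * e) := mul_le_mul hδ' h4 (abs_nonneg _) (by positivity)
    have hsum : |k x| + ε * |flipNoise L g x| + γ * (|δ| / 2 * |a| + |δ| / 2 * |b|) ≤
        (2 / ϑs + T) * e + ε * (2 * L * C₁ * e) + γ * (T / 2 * (C₁ * e) + T / 2 * (C₁ * e)) :=
      add_le_add (add_le_add (hkb x) (mul_le_mul_of_nonneg_left hS hε.le))
        (mul_le_mul_of_nonneg_left (add_le_add hA hB) hγ.le)
    calc |-k x - ε * flipNoise L g x + γ * (δ / 2 * a + -(δ / 2) * b)|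
        ≤ (2 / ϑs + T) * e + ε * (2 * L * C₁ * e) + γ * (T / 2 * (C₁ * e) + T / 2 * (C₁ * e)) := e1.trans hsum
      _ = ((2 / ϑs + T) + γ * T * C₁ + ε * (2 * L * C₁)) * e := by ring
      _ ≤ Cs * e := mul_le_mul_of_nonneg_right hKCs hE
  -- (4) the family near `δ = 0` and weak flip stationarity tested on `g`
  set μf : ℝ → Measure (PhaseSpace L) := fun δ => μ L (T + δ / 2) (T - δ / 2) with hμf
  set ϑ' : ℝ := (ϑs + 2 / (3 * T)) / 2 with hϑ'
  have hϑs23 : ϑs < 2 / (3 * T) := by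
    have h1 : ϑs < 1 / (2 * T) := by rw [lt_div_iff₀ (by positivity)]; rw [lt_div_iff₀ hT] at h2ϑs; linarith
    have h2 : 1 / (2 * T) < 2 / (3 * T) := by rw [div_lt_div_iff₀ (by positivity) (by positivity)]; nlinarith
    linarith
  have hϑsϑ' : ϑs < ϑ' := by rw [hϑ']; linarith
  have hϑ'23 : ϑ' < 2 / (3 * T) := by rw [hϑ']; linarith
  have hmaxinv : ∀ δ : ℝ, |δ| < T → 2 / (3 * T) < 1 / max (T + δ / 2) (T - δ / 2) := by
    intro δ hδ
    have hδ1 := abs_lt.1 hδ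
    have hmax : max (T + δ / 2) (T - δ / 2) < 3 * T / 2 := max_lt (by linarith) (by linarith)
    have hmax0 : 0 < max (T + δ / 2) (T - δ / 2) := lt_max_of_lt_left (by linarith)
    rw [div_lt_div_iff₀ (by positivity) hmax0]; nlinarith
  have hstat : ∀ δ : ℝ, |δ| < T → δ ≠ 0 →
      (∫ y, k y ∂(μf δ)) / δ = γ / 2 * ((∫ x, partialP i0 (partialP i0 g) x ∂(μf δ)) -
        ∫ x, partialP i1 (partialP i1 g) x ∂(μf δ)) := by
    intro δ hδ hδ0
    have hδ1 := abs_lt.1 hδ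
    have hTL : 0 < T + δ / 2 := by linarith
    have hTR : 0 < T - δ / 2 := by linarith
    have hfam := hμ L _ _ hTL hTR
    haveI : IsProbabilityMeasure (μf δ) := hfam.1.isProbabilityMeasure
    have hϑ'1 : ϑ' < 1 / max (T + δ / 2) (T - δ / 2) := hϑ'23.trans (hmaxinv δ hδ)
    have hϑ'0 : 0 < ϑ' := hϑs0.trans hϑsϑ'
    have hexp : Integrable (fun x => Real.exp (ϑ' * H x)) (μf δ) :=
      integrable_exp_of_unique hω hl hβ hγ hTL hTR hε hfam hϑ'0 hϑ'1
    have hweak := hfam.1.2.1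
    have h0 := pinnedChain_integral_flipGenerator_eq_zero_of_expGrowth hω hl.le hβ.le hγ.le hL hTL.le hTR.le ε
      (μf δ) hweak hϑsϑ' hexp hgs hgb (hLδb δ hδ) hP0 hP1
    have hexps : Integrable (fun x => Real.exp (ϑs * H x)) (μf δ) :=
      integrable_exp_of_unique hω hl hβ hγ hTL hTR hε hfam hϑs0 (hϑsϑ'.trans hϑ'1)
    have hki : Integrable k (μf δ) := integrable_of_abs_le_exp hexps hkc hkb
    have hdd0 : Integrable (partialP i0 (partialP i0 g)) (μf δ) :=
      integrable_of_abs_le_exp hexps hdd0c fun x => (hgrad x).2.2.1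
    have hdd1 : Integrable (partialP i1 (partialP i1 g)) (μf δ) :=
      integrable_of_abs_le_exp hexps hdd1c fun x => (hgrad x).2.2.2
    have e1 : (fun x => P.flipGenerator L (T + δ / 2) (T - δ / 2) ε g x) = fun x =>
        (γ * (δ / 2) * partialP i0 (partialP i0 g) x - γ * (δ / 2) * partialP i1 (partialP i1 g) x) - k x := by
      funext x; rw [hLδ δ x]; ring
    have I1 : Integrable (fun x => γ * (δ / 2) * partialP i0 (partialP i0 g) x) (μf δ) := hdd0.const_mul _
    have I2 : Integrable (fun x => γ * (δ / 2) * partialP i1 (partialP i1 g) x) (μf δ) := hdd1.const_mul _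
    have I12 : Integrable (fun x => γ * (δ / 2) * partialP i0 (partialP i0 g) x -
        γ * (δ / 2) * partialP i1 (partialP i1 g) x) (μf δ) := I1.sub I2
    rw [e1, integral_sub I12 hki, integral_sub I1 I2, integral_const_mul, integral_const_mul] at h0
    have hIk : ∫ y, k y ∂(μf δ) = γ * (δ / 2) * (∫ x, partialP i0 (partialP i0 g) x ∂(μf δ)) -
        γ * (δ / 2) * ∫ x, partialP i1 (partialP i1 g) x ∂(μf δ) := by linarith
    rw [hIk]
    field_simp
  -- (5) weak continuity of the flip family on `∂²_{p_b} g` and the equilibrium values (Gaussian IBP)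
  have hμTT : μ L T T = μT := family_eq_gibbsMeasure hω hl.le hβ.le γ ε hμ L hT
  have hϑ₁' : ϑ₁ < 1 / (2 * T) := by rw [lt_div_iff₀ (by positivity)]; rw [lt_div_iff₀ hT] at h2ϑ₁; linarith
  obtain ⟨M, hM⟩ := flip_uniform_exp_moment hω hl hβ hγ hε μ hμ hT hL2
  have hlim0 := (flip_tendsto_integral_of_growth hω hl hβ ε μ hμ hT hM hdd0c hϑ₁.le hϑ₁'
    fun x => (hgrad x).2.2.1).2
  have hlim1 := (flip_tendsto_integral_of_growth hω hl hβ ε μ hμ hT hM hdd1c hϑ₁.le hϑ₁'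
    fun x => (hgrad x).2.2.2).2
  rw [hμTT] at hlim0 hlim1
  have hexpT : Integrable (fun x => Real.exp (ϑ₁ * H x)) μT :=
    pinnedChain_integrable_exp_mul_hamiltonian_gibbsMeasure hω hl.le hβ.le γ L hT (by linarith)
  have hA0 := pinnedChain_integral_partialP_partialP_gibbsMeasure hω hl.le hβ.le γ L hT i0 hgd
    (hd0s.differentiable (by norm_num)) hgL2
    (memLp_two_of_abs_le_exp hω hl.le hβ.le γ L hT h2ϑ₁ hd0s.continuous fun x => (hgrad x).1)
    (integrable_of_abs_le_exp hexpT hdd0c fun x => (hgrad x).2.2.1)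
  have hB0 := pinnedChain_integral_partialP_partialP_gibbsMeasure hω hl.le hβ.le γ L hT i1 hgd
    (hd1s.differentiable (by norm_num)) hgL2
    (memLp_two_of_abs_le_exp hω hl.le hβ.le γ L hT h2ϑ₁ hd1s.continuous fun x => (hgrad x).2.1)
    (integrable_of_abs_le_exp hexpT hdd1c fun x => (hgrad x).2.2.2)
  set A : ℝ := ∫ x, g x * (kin L 0 x - T) ∂μT with hA
  set B : ℝ := ∫ x, g x * (kin L (L - 1) x - T) ∂μT with hB
  have hA' : ∫ x, partialP i0 (partialP i0 g) x ∂μT = T⁻¹ ^ 2 * A := by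
    rw [hA0, hA]; congr 1
    refine integral_congr_ae (ae_of_all _ fun x => ?_)
    dsimp only
    rw [kin_eq_sq hL]
  have hB' : ∫ x, partialP i1 (partialP i1 g) x ∂μT = T⁻¹ ^ 2 * B := by
    rw [hB0, hB]; congr 1
    refine integral_congr_ae (ae_of_all _ fun x => ?_)
    dsimp only
    rw [kin_eq_sq hL1]
  rw [hA'] at hlim0
  rw [hB'] at hlim1
  -- (6) the limit of `⟨k_0⟩_δ/δ`
  have hball : ∀ᶠ δ in 𝓝 (0 : ℝ), |δ| < T := by
    have : Metric.ball (0 : ℝ) T ∈ 𝓝 (0 : ℝ) := Metric.ball_mem_nhds 0 hT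
    filter_upwards [this] with δ hδ
    simpa [Real.dist_eq] using hδ
  have hlimk : Tendsto (fun δ : ℝ => (∫ y, k y ∂(μf δ)) / δ) (𝓝[≠] 0)
      (𝓝 (γ / 2 * (T⁻¹ ^ 2 * A - T⁻¹ ^ 2 * B))) := by
    have h := (hlim0.sub hlim1).const_mul (γ / 2)
    refine h.congr' ?_
    filter_upwards [hball.filter_mono nhdsWithin_le_nhds, self_mem_nhdsWithin] with δ hδ hδ0
    rw [Set.mem_compl_iff, Set.mem_singleton_iff] at hδ0
    exact (hstat δ hδ hδ0).symm
  -- (7) energy balance and the response coefficient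
  have hbal : ∀ᶠ δ in 𝓝[≠] (0 : ℝ),
      ((L : ℝ) - 1) * γ * (1 / 2 - (∫ y, k y ∂(μf δ)) / δ) = P.totalCurrent (μf δ) / δ := by
    filter_upwards [hball.filter_mono nhdsWithin_le_nhds, self_mem_nhdsWithin] with δ hδ hδ0
    rw [Set.mem_compl_iff, Set.mem_singleton_iff] at hδ0
    have hδ1 := abs_lt.1 hδ
    have hTL : 0 < T + δ / 2 := by linarith
    have hTR : 0 < T - δ / 2 := by linarith
    have hfam := hμ L _ _ hTL hTR
    haveI : IsProbabilityMeasure (μf δ) := hfam.1.isProbabilityMeasure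
    have htc := VanishingNoiseBound.totalCurrent_eq_left hω hl.le hβ.le hγ hL hTL.le hTR.le hfam.1
    have hexps : Integrable (fun x => Real.exp (ϑs * H x)) (μf δ) :=
      integrable_exp_of_unique hω hl hβ hγ hTL hTR hε hfam hϑs0 (hϑs23.trans (hmaxinv δ hδ))
    have hkint : Integrable k (μf δ) := integrable_of_abs_le_exp hexps hkc hkb
    have hp2 : ∫ x, x.2 ⟨0, hL⟩ ^ 2 ∂(μf δ) = (∫ y, k y ∂(μf δ)) + T := by
      have e : (fun x : PhaseSpace L => x.2 ⟨0, hL⟩ ^ 2) = fun x => k x + T := by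
        funext x; simp [hk, hi0]
      rw [e, integral_add hkint (integrable_const T), integral_const, probReal_univ, one_smul]
    rw [htc, hp2]
    field_simp
    ring
  have hlimJ : Tendsto (fun δ : ℝ => P.totalCurrent (μf δ) / δ) (𝓝[≠] 0)
      (𝓝 (((L : ℝ) - 1) * γ * (1 / 2 - γ / 2 * (T⁻¹ ^ 2 * A - T⁻¹ ^ 2 * B)))) :=
    ((hlimk.const_sub (1 / 2)).const_mul (((L : ℝ) - 1) * γ)).congr' hbal
  have hDL : D L = ((L : ℝ) - 1) * γ * (1 / 2 - γ / 2 * (T⁻¹ ^ 2 * A - T⁻¹ ^ 2 * B)) :=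
    tendsto_nhds_unique hD hlimJ
  -- (8) the row sum and the algebra
  have hrow : A + B = T ^ 2 / γ := flip_rowSum hω hl hβ hγ hT ε hL2 hC hgL2 hpde
  have hBeq : B = T ^ 2 / γ - A := by linarith
  have hL1r : ((L : ℝ) - 1) ≠ 0 := by
    have : (2 : ℝ) ≤ (L : ℝ) := by exact_mod_cast hL2
    linarith
  have hT0 : T ≠ 0 := hT.ne'
  rw [hDL, hBeq]
  field_simp
  ring

end Link

/-! ## Registered helper -/

/-- Registered helper sub-goal `helper_noisyKuboLink` of stub `stub_noisyPositiveConductance` (line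
`fekete-usc-one-length`, crux stmt-AtomisticToContinuum-11976): the mixing-free finite-volume Green–Kubo formula of
the velocity-flip chain, `D_L/(L−1) = γ(1 − (γ/T²)⟨g, p_0² − T⟩_{μ_T})`, for every classical exponentially bounded
forward field `g` of `L_{T,T} + εS` (`flip_kuboLink_of_forwardField`). -/
theorem helper_noisyKuboLink : ∀ (ω₂ lam β γ : ℝ) (μ : (N : ℕ) → ℝ → ℝ → MeasureTheory.Measure (Literature.MathematicalPhysics.KineticTheory.HeatConduction.PhaseSpace N)) (T ε : ℝ) (D : ℕ → ℝ), 0 < ω₂ → 0 < lam → 0 < β → 0 < γ → 0 < T → 0 < ε → (∀ (N : ℕ) (T_L T_R : ℝ), 0 < T_L → 0 < T_R → (Literature.MathematicalPhysics.KineticTheory.HeatConduction.pinnedChain ω₂ lam β γ).IsFlipSteadyState N T_L T_R ε (μ N T_L T_R) ∧ ∀ ν : MeasureTheory.Measure (Literature.MathematicalPhysics.KineticTheory.HeatConduction.PhaseSpace N), (Literature.MathematicalPhysics.KineticTheory.HeatConduction.pinnedChain ω₂ lam β γ).IsFlipSteadyState N T_L T_R ε ν → ν = μ N T_L T_R) →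 ∀ (L : ℕ) (hL : 2 ≤ L), Filter.Tendsto (fun δ : ℝ => (Literature.MathematicalPhysics.KineticTheory.HeatConduction.pinnedChain ω₂ lam β γ).totalCurrent (μ L (T + δ / 2) (T - δ / 2)) / δ) (nhdsWithin 0 {(0 : ℝ)}ᶜ) (nhds (D L)) → ∀ (g : Literature.MathematicalPhysics.KineticTheory.HeatConduction.PhaseSpace L → ℝ), ContDiff ℝ ((⊤ : ℕ∞) : WithTop ℕ∞) g → (∀ x, (Literature.MathematicalPhysics.KineticTheory.HeatConduction.pinnedChain ω₂ lam β γ).flipGenerator L T T ε g x = -(Summit.AtomisticToContinuum.FouriersLaw.Theorems.SuperadditiveResistance.DeviceLiouville.kin L 0 x - T)) → ∀ (C₁ ϑ₁ : ℝ), 0 < ϑ₁ → 2 * ϑ₁ < 1 / T → (∀ x, |g x| ≤ C₁ * Real.exp (ϑ₁ * (Literature.MathematicalPhysics.KineticTheory.HeatConduction.pinnedChain ω₂ lam β γ).hamiltonian L x)) → (∀ x, |Literature.MathematicalPhysics.KineticTheory.HeatConduction.partialP (⟨0, by omega⟩ : Fin L) g x| ≤ C₁ * Real.exp (ϑ₁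 * (Literature.MathematicalPhysics.KineticTheory.HeatConduction.pinnedChain ω₂ lam β γ).hamiltonian L x) ∧ |Literature.MathematicalPhysics.KineticTheory.HeatConduction.partialP (⟨L - 1, by omega⟩ : Fin L) g x| ≤ C₁ * Real.exp (ϑ₁ * (Literature.MathematicalPhysics.KineticTheory.HeatConduction.pinnedChain ω₂ lam β γ).hamiltonian L x) ∧ |Literature.MathematicalPhysics.KineticTheory.HeatConduction.partialP (⟨0, by omega⟩ : Fin L) (Literature.MathematicalPhysics.KineticTheory.HeatConduction.partialP (⟨0, by omega⟩ : Fin L) g) x| ≤ C₁ * Real.exp (ϑ₁ * (Literature.MathematicalPhysics.KineticTheory.HeatConduction.pinnedChain ω₂ lam β γ).hamiltonian L x) ∧ |Literature.MathematicalPhysics.KineticTheory.HeatConduction.partialP (⟨L - 1, by omega⟩ : Fin L) (Literature.MathematicalPhysics.KineticTheory.HeatConduction.partialP (⟨L - 1, by omega⟩ : Fin L) g) x| ≤ C₁ * Real.exp (ϑ₁ * (Literature.MathematicalPhysics.KineticTheory.HeatConduction.pinnedChain ω₂ lam β γ).hamiltonian L x)) → D L / ((L : ℝ) - 1) = γ *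 (1 - γ / T ^ 2 * MeasureTheory.integral ((Literature.MathematicalPhysics.KineticTheory.HeatConduction.pinnedChain ω₂ lam β γ).gibbsMeasure L T) (fun x => g x * (Summit.AtomisticToContinuum.FouriersLaw.Theorems.SuperadditiveResistance.DeviceLiouville.kin L 0 x - T))) :=
  fun _ _ _ _ μ _ _ D hω hl hβ hγ hT hε hμ _ hL hD _ hgs hpde _ _ hϑ₁ h2ϑ₁ hgb0 hgrad =>
    flip_kuboLink_of_forwardField μ D hω hl hβ hγ hT hε hμ hL hD hgs hpde hϑ₁ h2ϑ₁ hgb0 hgrad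

end Summit.AtomisticToContinuum.FouriersLaw.Theorems.VanishingNoiseBound

end
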